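import Literature.NumberTheory.Rogawski1990.U3Readings

/-!
# The archimedean reading `reading_fixedRule` of Rogawski's classification, resolved into PRINT +
# a COMPUTED parameter + kernel

Companion of `Literature/NumberTheory/Rogawski1990/U3Readings.lean`.  There, the only non-verbatim
archimedean item of the Dimitrov–Ramakrishnan form of Rogawski's classification is the READING
`U3Spectrum.reading_fixedRule` — "there is ONE embedding `e ∈ {ι, ῑ}` such that, for every
`(λ,ν) ∈ Ξ` with CM type `Φ`, `π_n(λ_ι,ν_ι) = π⁺` when `e ∈ Φ` and `= π⁻` when `ē ∈ Φ`", read from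
the proof sentence [DimitrovRamakrishnan2015, p. 9] "hence for every Archimedean place `v` one has
`π_n(λ_v,ν_v) = π⁺` or `π⁻`, depending on the choice of isomorphism `M ⊗_{F,v} ℝ ≃ ℂ` in the CM
type `Φ`" (the uniformity in `(λ,ν)` is inferred, not printed).  This file shows WHAT EXACTLY is
inferred: over one further posited primitive — the restriction to `ℂ^× = W_{M_w}` of the
archimedean L-parameter of a representation of `G_ι ≅ U(2,1)`, written in the coordinate `ι` — the
reading is EQUIVALENT (kernel, `exists_archParam_iff`) to the conjunction of
* **P** `ArchParam.langlands_Jpm` — [DimitrovRamakrishnan2015, p. 9, citing [langlands]] VERBATIM: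
  "the restrictions to `ℂ^×` of the Langlands parameters of `π⁺` and `π⁻` are given by
  `z ↦ diag(z̄, z/z̄, z⁻¹)` and its complex conjugate" (typed as an UNORDERED pair, since the source
  does not say in which of the two isomorphisms `M_w ≃ ℂ` the matrix is written);
* **U (COMPUTED)** `ArchParam.pin_paramC` — the `ℂ^×`-parameter of `π_n(λ_v,ν_v)` COMPUTED from
  [DimitrovRamakrishnan2015]'s display (12) ("the (Langlands) quotient representation of the
  induction of the character … `(ᾱ,β,α⁻¹) ↦ λ_v(ᾱ)|α|_{M_v}^{3/2} ν_v(β)`", unitary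
  normalisation: "divide … by `(ᾱ,β,α⁻¹) ↦ |α|_{M_v}`") and Def 3.1 (the archimedean exponents of
  `λ, ν`, typed in `U3Spectrum.IsXiWith`) by the STANDARD parameter recipe (below);
given the verbatim (i) `U3Spectrum.thm32_i` ("`π_n(λ_v,ν_v) = π⁺` or `π⁻`") and `π⁺ ≠ π⁻`
(`dr_localPacket_iota`).  The kernel also CERTIFIES the computation against print: at the exponents
forced by `ι ∈ Φ` the computed parameter IS the displayed parameter of `π⁺`, and at those forced by
`ῑ ∈ Φ` it is its complex conjugate (`pinCode_of_mem`, `pinCode_of_conj_mem`) — and it records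
(`pinCode_DRnuM_ne`) that with the OTHER printed convention "`ν_M(z) = ν(z̄/z)`" of
[DimitrovRamakrishnan2015] Thm 3.2(iii) the computed parameter would be neither (the displayed
conventions are consistent exactly with `ν_M(z) = ν(z/z̄)` = [Rogawski1990] §11.1 "`χ̃(a) = χ(a/ā)`").

THE STANDARD RECIPE (class STD; NOT a quotation; used only inside the docstring of `pin_paramC`).
(a) Local Langlands for the real torus `T = Res_{ℂ/ℝ}𝔾_m × U(1)` (the diagonal torus
`{d(a, β, ā⁻¹)}` of `U(2,1)(ℝ)`, `T(ℂ) = {diag(x,y,z)}` with `σ(x,y,z) = (z̄⁻¹, ȳ⁻¹, x̄⁻¹)`): the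
L-parameter of a character `θ = θ₁(a)θ₂(β)` restricted to `W_ℂ = ℂ^×` is the base change
`θ ∘ N_{ℂ/ℝ}`, `N(t) = t·σ(t)`, i.e. the character `diag(x,y,z) ↦ θ₁(x) · θ₂(y/ȳ) · θ₁(z̄)⁻¹` of
`T(ℂ)` (Langlands' correspondence for tori and its functoriality under base change; exposition:
Borel, *Automorphic L-functions*, PSPM 33.2 (1979) §9); (b) Langlands' classification: the
L-parameter of the Langlands quotient `J(B, χ)` of the normalised induced representation of a
character `χ` of `T(ℝ)` in the closed positive chamber is the L-parameter of `χ` composed with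
`ᴸT → ᴸG` (ibid. §§10–11); (c) `‖z‖_{ℂ} = z z̄`.  With `χ = (a ↦ λ_w(a)‖a‖^{1/2}) ⊗ ν_w` (display
(12), normalised), `λ_w(z) = (z/|z|)^e`, `ν_w(u) = u^m` in the coordinate `ι` this gives
`φ(π_n(λ_v,ν_v))|_{ℂ^×} = {λ_w‖·‖^{1/2}, (y ↦ ν_w(y/ȳ)), (λ_w ∘ conj)⁻¹‖·‖^{−1/2}} =
{z^{(e+1)/2} z̄^{(1−e)/2}, z^m z̄^{−m}, z^{(e−1)/2} z̄^{(−e−1)/2}}` — the multiset `pinCode e m` below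
(exponents DOUBLED to stay in `ℤ`).

## References

* M. Dimitrov, D. Ramakrishnan, Doc. Math. 20 (2015): §3.1 p. 8 (held text `paper:arxiv-1401.1628`
  chunk p0008 L23–34: the packet at a non-split place, display (12), the unitary normalisation;
  L50–63: CM types and Def 3.1), proof of Thm 3.2 p. 9 (chunk p0009 L1–7).
  [DimitrovRamakrishnan2015]
* J. Rogawski, Ann. of Math. Stud. 123 (1990), §11.1, §12.3 p. 178. [Rogawski1990]
* R. P. Langlands, *Les débuts d'une formule des traces stable*, Publ. Math. Univ. Paris 7, 13
  (1983) (= [langlands] of [DimitrovRamakrishnan2015]; cited through it).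
-/

noncomputable section

open NumberField NumberField.ComplexEmbedding

namespace Literature.NumberTheory.Rogawski1990

open Literature.AlgebraicGeometry.Motives (CMType)
open Literature.NumberTheory.ComplexMultiplication.CMTypeOps

universe u

/-- **Exponent codes.**  `(a, b) : ℤ × ℤ` encodes the quasi-character `z ↦ z^{a/2} z̄^{b/2}` of `ℂ^× = W_ℂ` (exponents
DOUBLED, so that the unitary characters `(z/|z|)^e = z^{e/2} z̄^{−e/2}` of [DimitrovRamakrishnan2015] Def 3.1 have integral codes
`(e, −e)`); a multiset of three codes encodes the restriction to `ℂ^×` of a 3-dimensional L-parameter.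
[folklore] -/
abbrev ExpCode := ℤ × ℤ

namespace ExpCode

/-- Complex conjugation of the coordinate: `z^{a/2} z̄^{b/2} ↦ z^{b/2} z̄^{a/2}`. [folklore] -/
def conj (x : ExpCode) : ExpCode := (x.2, x.1)

/-- Unfolding of `conj`. [folklore] -/
@[simp] theorem conj_mk (a b : ℤ) : conj (a, b) = (b, a) := rfl

end ExpCode

/-- `D⁺ :=` the code of [DimitrovRamakrishnan2015, p. 9]'s displayed parameter "`z ↦ diag(z̄, z/z̄, z⁻¹)`":
`{z̄, z/z̄, z⁻¹} ↔ {(0,2), (2,−2), (−2,0)}`. [cite: DimitrovRamakrishnan2015, proof of Theorem 3.2, p. 9] -/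
def langlandsPlus : Multiset ExpCode := {(0, 2), (2, -2), (-2, 0)}

/-- `D⁻ :=` "its complex conjugate", `{z, z̄/z, z̄⁻¹} ↔ {(2,0), (−2,2), (0,−2)}` (`langlandsMinus_eq_map_conj`). [cite: DimitrovRamakrishnan2015, proof of Theorem 3.2, p. 9] -/
def langlandsMinus : Multiset ExpCode := {(2, 0), (-2, 2), (0, -2)}

/-- `D⁻` is the conjugate of `D⁺`. [cite: DimitrovRamakrishnan2015, proof of Theorem 3.2, p. 9] -/
theorem langlandsMinus_eq_map_conj : langlandsMinus = langlandsPlus.map ExpCode.conj := by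
  simp [langlandsMinus, langlandsPlus]

/-- `z̄ = (0,2)` occurs in `D⁺`. [cite: DimitrovRamakrishnan2015, proof of Theorem 3.2, p. 9] -/
theorem mem_langlandsPlus_zero_two : ((0 : ℤ), (2 : ℤ)) ∈ langlandsPlus := by
  simp [langlandsPlus]

/-- `(0,2)` does not occur in `D⁻`. [cite: DimitrovRamakrishnan2015, proof of Theorem 3.2, p. 9] -/
theorem not_mem_langlandsMinus_zero_two : ((0 : ℤ), (2 : ℤ)) ∉ langlandsMinus := by
  simp [langlandsMinus]

/-- `D⁺ ≠ D⁻` — the parameters of `π⁺` and `π⁻` differ. [cite: DimitrovRamakrishnan2015, proof of Theorem 3.2, p. 9] -/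
theorem langlandsPlus_ne_langlandsMinus : langlandsPlus ≠ langlandsMinus := fun h =>
  not_mem_langlandsMinus_zero_two (h ▸ mem_langlandsPlus_zero_two)

/-- **The COMPUTED code** of `φ(π_n(λ_v,ν_v))|_{ℂ^×}` for `λ_w(z) = (z/|z|)^e`, `ν_w(u) = u^m` (coordinate `ι`), by the
standard recipe of the module docstring: `{z^{(e+1)/2} z̄^{(1−e)/2}, z^{m} z̄^{−m}, z^{(e−1)/2} z̄^{(−e−1)/2}}` ↔
`{(e+1, 1−e), (2m, −2m), (e−1, −e−1)}`.
[cite: DimitrovRamakrishnan2015, §3.1 display (12) and Definition 3.1, p. 8] -/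
def pinCode (e m : ℤ) : Multiset ExpCode := {(e + 1, 1 - e), (2 * m, -(2 * m)), (e - 1, -e - 1)}

/-- CONSISTENCY CERTIFICATE, case `ι ∈ Φ` (Def 3.1 in the coordinate `ι`: `λ_w = (z/|z|)^{−1} = z̄/|z|`, `ν_w(u) = u`):
the computed parameter is EXACTLY [DimitrovRamakrishnan2015]'s displayed parameter of `π⁺`. [cite: DimitrovRamakrishnan2015, proof of Theorem 3.2, p. 9] -/
theorem pinCode_neg_one_one : pinCode (-1) 1 = langlandsPlus := by
  simp [pinCode, langlandsPlus]

/-- CONSISTENCY CERTIFICATE, case `ῑ ∈ Φ` (in the coordinate `ι`: `λ_w = z/|z|`, `ν_w(u) = u⁻¹`): the computed parameter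
is the complex conjugate `D⁻`. [cite: DimitrovRamakrishnan2015, proof of Theorem 3.2, p. 9] -/
theorem pinCode_one_neg_one : pinCode 1 (-1) = langlandsMinus := by
  simp [pinCode, langlandsMinus]

/-- Kernel witness for the CONVENTION NOTE on `ν_M` (docstring of `U3Spectrum`): were the middle entry taken with [DimitrovRamakrishnan2015] Thm 3.2(iii)'s printed "`ν_M(z) = ν(z̄/z)`"
(code `m ↦ −m`) instead of [Rogawski1990] §11.1's `χ̃(a) = χ(a/ā)`, the computed parameter for `ι ∈ Φ` would be
`{(0,2), (−2,2), (−2,0)}` — NEITHER `D⁺` NOR `D⁻` (its holomorphic exponents `{0,−1,−1}` are singular).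
[cite: DimitrovRamakrishnan2015, Theorem 3.2 (iii) vs. proof of Theorem 3.2, pp. 8–9] -/
theorem pinCode_DRnuM_ne :
    pinCode (-1) (-1) ≠ langlandsPlus ∧ pinCode (-1) (-1) ≠ langlandsMinus := by
  constructor
  · intro h
    have hmem : ((-2 : ℤ), (2 : ℤ)) ∈ pinCode (-1) (-1) := by simp [pinCode]
    rw [h] at hmem
    simp [langlandsPlus] at hmem
  · intro h
    have hmem : ((-2 : ℤ), (0 : ℤ)) ∈ pinCode (-1) (-1) := by simp [pinCode]
    rw [h] at hmem
    simp [langlandsMinus] at hmem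

namespace U3Spectrum

variable {M : Type u} [Field M] [NumberField M] [IsCMField M] {ι : M →+* ℂ} (S : U3Spectrum M ι)

/-- **Posited primitive** (one function, no propositional field): `paramC π_ι` = the restriction to `ℂ^× = W_{M_w}`
(`w` the place of `ι`) of the L-parameter of the irreducible unitary representation `π_ι` of `G_ι ≅ U(2,1)`, as a
multiset of three exponent codes, IN THE COORDINATE `ι` (`z = ι(·)`); conjugating the coordinate applies `ExpCode.conj`
to each code.  Meaningful exactly for the `π_ι` whose parameter on `ℂ^×` is a sum of characters `z^{p} z̄^{q}` with
`2p, 2q ∈ ℤ` — the case for every representation this file constrains (`π⁺`, `π⁻` by `langlands_Jpm`; `π_n(λ_ι,ν_ι)`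
by `pin_paramC`); on all other `π_ι` the value is unconstrained (no `Prop` below mentions it), so positing the
function is harmless there (`exists_archParam_iff`).  Intended meaning only; every assertion about it is one of the
`Prop`s below. [cite: DimitrovRamakrishnan2015, proof of Theorem 3.2, p. 9] -/
structure ArchParam : Type u where
  /-- `φ(π_ι)|_{ℂ^×}` in the coordinate `ι`, as exponent codes -/
  paramC : S.LocRep → Multiset ExpCode

namespace ArchParam

variable {S} (A : S.ArchParam)

/-- **P** [cite: DimitrovRamakrishnan2015, proof of Theorem 3.2, p. 9 (chunk p0009 L4–5)] "By [langlands] the restrictions to `ℂ^×` of the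
Langlands parameters of `π⁺` and `π⁻` are given by `z ↦ diag(z̄, z/z̄, z^{−1})` and its complex conjugate"
(`[langlands]` = R. P. Langlands, *Les débuts d'une formule des traces stable*, Publ. Math. Univ. Paris 7,
vol. 13, 1983 — [DimitrovRamakrishnan2015]'s bibliography, chunk p0015 L72–74).  Typed VERBATIM as an UNORDERED assignment: `{paramC π⁺, paramC π⁻} = {D⁺, D⁻}` —
the source does not say in which of the two identifications `M_w ≃ ℂ` the matrix is written, and this file's
coordinate is `ι`; nothing below depends on the order. -/
def langlands_Jpm (A : S.ArchParam) : Prop :=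
  (A.paramC S.Jp = langlandsPlus ∧ A.paramC S.Jm = langlandsMinus) ∨
    (A.paramC S.Jp = langlandsMinus ∧ A.paramC S.Jm = langlandsPlus)

/-- **U — COMPUTED READING (derived from [DimitrovRamakrishnan2015] display (12) + Def 3.1 by the standard parameter recipe; NOT a
verbatim statement).**  Print: [cite: DimitrovRamakrishnan2015, §3.1, p. 8 (chunk p0008 L23–34)] "At a place `v` of `F` which does not
split in `M`, which includes any Archimedean `v`, the local Arthur packet `Π'(λ_v,ν_v)` consists of a
square-integrable representation `π_s(λ_v,ν_v)` and a non-tempered representation `π_n(λ_v,ν_v)` of `G'(F_v)`. These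
constituents of the packet can be described (see [rogawski1]) as the unique subrepresentation and the corresponding
(Langlands) quotient representation of the induction of the character of `B(F_v)` which is trivial on the unipotent
subgroup and given on `T(F_v)` by: `(ᾱ, β, α^{−1}) ↦ λ_v(ᾱ)|α|_{M_v}^{3/2} ν_v(β)`, where `α ∈ M_v^×`, `β ∈ M_v^1`.
If one considers unitary induction, then one has to divide the above character by the square root of the modular
character of `B(F_v)`, that is to say by `(ᾱ,β,α^{−1}) ↦ |α|_{M_v}`"; and Definition 3.1, p. 8 (typed
`U3Spectrum.IsXiWith`): in the coordinate of the isomorphism in `Φ`, `λ_v(z) = z̄_v/|z_v|`, `ν_v(z) = z_v` — so in the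
FIXED coordinate `ι`: `λ_w = (z/|z|)^e`, `ν_w(u) = u^m` with `e = S.expo λ ι`, `m = S.aexpo ν ι` (`= (−1, 1)` if
`ι ∈ Φ`, `= (1, −1)` if `ῑ ∈ Φ`).  COMPUTATION (module docstring, recipe (a)–(c)): the normalised inducing character
is `χ = (a ↦ λ_w(a)‖a‖^{1/2}) ⊗ ν_w` on `d(a, β, ā⁻¹)`, and the `ℂ^×`-parameter of its Langlands quotient
`π_n(λ_v,ν_v)` is `{λ_w‖·‖^{1/2}, (y ↦ ν_w(y/ȳ)), (λ_w∘conj)⁻¹‖·‖^{−1/2}}`, code `pinCode e m`.  Class: U (computed-from-print). -/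
def pin_paramC (A : S.ArchParam) : Prop :=
  ∀ (lam : S.HChar) (nu : S.AChar), S.InXi lam nu →
    A.paramC (S.pin lam nu) = pinCode (S.expo lam ι) (S.aexpo nu ι)

/-! ### Kernel -/

/-- K.  Def 3.1 at the place of `ι`, case `ι ∈ Φ`: exponents `(e, m) = (−1, 1)`, computed code `= D⁺`.
[cite: DimitrovRamakrishnan2015, Definition 3.1, p. 8] -/
theorem pinCode_of_mem {lam : S.HChar} {nu : S.AChar} {Φ : CMType M} (hΦ : S.IsXiWith lam nu Φ)
    (hι : ι ∈ Φ.1) : pinCode (S.expo lam ι) (S.aexpo nu ι) = langlandsPlus := by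
  rw [(hΦ.2.1 ι hι).1, (hΦ.2.2 ι hι).1]
  exact pinCode_neg_one_one

/-- K.  Def 3.1 at the place of `ι`, case `ῑ ∈ Φ`: exponents `(e, m) = (1, −1)`, computed code `= D⁻`.
[cite: DimitrovRamakrishnan2015, Definition 3.1, p. 8] -/
theorem pinCode_of_conj_mem {lam : S.HChar} {nu : S.AChar} {Φ : CMType M} (hΦ : S.IsXiWith lam nu Φ)
    (hι : conjugate ι ∈ Φ.1) : pinCode (S.expo lam ι) (S.aexpo nu ι) = langlandsMinus := by
  have h1 := (hΦ.2.1 (conjugate ι) hι).2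
  have h2 := (hΦ.2.2 (conjugate ι) hι).2
  rw [show conjugate (conjugate ι) = ι from involutive_conjugate M ι] at h1 h2
  rw [h1, h2]
  exact pinCode_one_neg_one

/-- **The fixed rule DERIVED**: the verbatim [langlands] parameters of `π^±` (P), the computed parameter of
`π_n(λ_v,ν_v)` (U-computed) and the verbatim (i) "`π_n(λ_v,ν_v) = π⁺` or `π⁻`" (P, `U3Spectrum.thm32_i`) imply
`U3Spectrum.reading_fixedRule`, with `e = ι` or `e = ῑ` according to which of `π^±` carries `D⁺` in the coordinate `ι`.
[cite: DimitrovRamakrishnan2015, proof of Theorem 3.2, p. 9] -/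
theorem reading_fixedRule_of (hL : A.langlands_Jpm) (hpin : A.pin_paramC) (hi : S.thm32_i) :
    S.reading_fixedRule := by
  have hne := langlandsPlus_ne_langlandsMinus
  -- the computed code of `π_n(λ_ι,ν_ι)` under a CM type `Φ`, in the two cases
  have key : ∀ (lam : S.HChar) (nu : S.AChar) (Φ : CMType M), S.IsXiWith lam nu Φ →
      (ι ∈ Φ.1 → A.paramC (S.pin lam nu) = langlandsPlus) ∧
        (conjugate ι ∈ Φ.1 → A.paramC (S.pin lam nu) = langlandsMinus) := by
    intro lam nu Φ hΦ
    have h := hpin lam nu ⟨Φ, hΦ⟩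
    exact ⟨fun hι => h.trans (pinCode_of_mem hΦ hι), fun hι => h.trans (pinCode_of_conj_mem hΦ hι)⟩
  rcases hL with ⟨hp, hm⟩ | ⟨hp, hm⟩
  · -- `π⁺ ↦ D⁺` in the coordinate `ι`: the rule holds with `e = ι`
    refine ⟨ι, by simp [placeSet], fun lam nu Φ hΦ => ⟨fun hι => ?_, fun hι => ?_⟩⟩
    · rcases hi lam nu ⟨Φ, hΦ⟩ with h | h
      · exact h
      · exfalso
        have := ((key lam nu Φ hΦ).1 hι).symm.trans (h ▸ hm :  A.paramC (S.pin lam nu) = langlandsMinus)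
        exact hne this
    · rcases hi lam nu ⟨Φ, hΦ⟩ with h | h
      · exfalso
        have := ((key lam nu Φ hΦ).2 hι).symm.trans (h ▸ hp : A.paramC (S.pin lam nu) = langlandsPlus)
        exact hne this.symm
      · exact h
  · -- `π⁺ ↦ D⁻` in the coordinate `ι`: the rule holds with `e = ῑ`
    refine ⟨conjugate ι, by simp [placeSet], fun lam nu Φ hΦ => ⟨fun hι => ?_, fun hι => ?_⟩⟩
    · rcases hi lam nu ⟨Φ, hΦ⟩ with h | h
      · exact h
      · exfalso
        have := ((key lam nu Φ hΦ).2 hι).symm.trans (h ▸ hm : A.paramC (S.pin lam nu) = langlandsPlus)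
        exact hne this.symm
    · rw [show conjugate (conjugate ι) = ι from involutive_conjugate M ι] at hι
      rcases hi lam nu ⟨Φ, hΦ⟩ with h | h
      · exfalso
        have := ((key lam nu Φ hΦ).1 hι).symm.trans (h ▸ hp : A.paramC (S.pin lam nu) = langlandsMinus)
        exact hne this
      · exact h

/-- K.  Hence the holomorphy dichotomy of `U3Readings.lean` from VERBATIM items + the computed parameter + the standard
input (no prose reading left): `thm32_members_iota` (P), `dr_localPacket_iota` (P), `thm32_i` (P), `langlands_Jpm` (P),
`pin_paramC` (U-computed), `SqIntTempered` (STD). [cite: DimitrovRamakrishnan2015, Theorem 3.2 and proof, pp. 8–9] -/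
theorem holomorphyDichotomy_of (hmem : S.thm32_members_iota) (hloc : S.dr_localPacket_iota) (hi : S.thm32_i)
    (hL : A.langlands_Jpm) (hpin : A.pin_paramC)
    (hstd : S.SqIntTempered) : S.holomorphyDichotomy :=
  S.holomorphyDichotomy_of hmem hloc (A.reading_fixedRule_of hL hpin hi) hstd

end ArchParam

/-- **EXACT STRENGTH.**  Over any carrier with `π⁺ ≠ π⁻` (`dr_localPacket_iota`, P) and (i)
(`thm32_i`, P): positing `ℂ^×`-parameter data with the verbatim [langlands] parameters and the computed parameter of
`π_n` is CONSERVATIVE over the reading — `(∃ A, A.langlands_Jpm ∧ A.pin_paramC) ↔ reading_fixedRule`.  So a consumer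
who takes `(A, hL, hpin)` instead of `InputR.fixedRule` assumes exactly the same thing about `S`; what changed is the
provenance: print + a standard computation (kernel-certified against print) instead of a prose reading. [folklore] -/
theorem exists_archParam_iff (hloc : S.dr_localPacket_iota) (hi : S.thm32_i) :
    (∃ A : S.ArchParam, A.langlands_Jpm ∧ A.pin_paramC) ↔ S.reading_fixedRule := by
  classical
  constructor
  · rintro ⟨A, hL, hpin⟩
    exact A.reading_fixedRule_of hL hpin hi
  · rintro ⟨e, he, hrule⟩
    have hJ : S.Jp ≠ S.Jm := hloc.2.1
    -- which code `π⁺` gets in the coordinate `ι`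
    let P : Multiset ExpCode := if e = ι then langlandsPlus else langlandsMinus
    let Q : Multiset ExpCode := if e = ι then langlandsMinus else langlandsPlus
    refine ⟨⟨fun x => if x = S.Jp then P else if x = S.Jm then Q else 0⟩, ?_, ?_⟩
    · by_cases heι : e = ι
      · left; constructor <;> simp [P, Q, heι, hJ.symm]
      · right; constructor <;> simp [P, Q, heι, hJ.symm]
    · intro lam nu hx
      obtain ⟨Φ, hΦ⟩ := hx
      have hr := hrule lam nu Φ hΦ
      -- `e` is `ι` or `ῑ`
      have he' : e = ι ∨ e = conjugate ι := by simpa [placeSet] using he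
      by_cases hι : ι ∈ Φ.1
      · rw [ArchParam.pinCode_of_mem hΦ hι]
        rcases he' with rfl | rfl
        · have hp : S.pin lam nu = S.Jp := hr.1 hι
          simp [hp, P]
        · have hm : S.pin lam nu = S.Jm :=
            hr.2 (by rw [show conjugate (conjugate ι) = ι from involutive_conjugate M ι]; exact hι)
          have hne : conjugate ι ≠ ι := by
            intro h
            have hc : conjugate ι ∈ Φ.1 := by rw [h]; exact hι
            exact ((conjugate_mem_iff_notMem Φ ι).mp hc) hι
          simp [hm, hJ.symm, Q, hne]
      · have hcι : conjugate ι ∈ Φ.1 := (conjugate_mem_iff_notMem Φ ι).mpr hι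
        rw [ArchParam.pinCode_of_conj_mem hΦ hcι]
        rcases he' with rfl | rfl
        · have hm : S.pin lam nu = S.Jm := hr.2 hcι
          simp [hm, hJ.symm, Q]
        · have hp : S.pin lam nu = S.Jp := hr.1 hcι
          have hne : conjugate ι ≠ ι := by
            intro h
            have hc : ι ∈ Φ.1 := by rw [← h]; exact hcι
            exact hι hc
          simp [hp, P, hne]

end U3Spectrum

end Literature.NumberTheory.Rogawski1990

end
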